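/-
Origin: expansion seat `planner-pub-hodgecm-toy2-g7-0`, handover #4 HANDOVER 2026-08-18T13:17:53Z (l.3882) md5 2e817c0d; rewrites ToyG3.DescentFacts3, Toy2g7.InertAtom (packager row: handed in STATUS without a t30 kit row; RUN 30 addendum) (`HOME/pub-hodgecm-toy2-g7/lean/Toy2g7/F4Row.lean`, md5 2e817c0d, 140 lines);
landed by the gen-8 packager in gate run 30 as `HodgeCM/Model/Toy/F4Row.lean` (import ^import Toy2g7\.InertAtom[ \t]*$→import HodgeCM.Model.Toy.InertAtom ×1; import ^import ToyG3\.DescentFacts3[ \t]*$→import HodgeCM.Model.ToyG2.DescentFacts3 ×1).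
-/
/-
Origin: CONSISTENCY seat 2 gen 7 `planner-pub-hodgecm-toy2-g7-0` (unit `pub-hodgecm-toy2-g7`), WIP
`HOME/pub-hodgecm-toy2-g7/lean/Toy2g7/F4Row.lean`; intended target `HodgeCM/Model/Toy/F4Row.lean` (new leaf).
-/
import Mathlib
import Summits.HodgeConjecture.HodgeCM.Model.Toy.LefTypes
import Summits.HodgeConjecture.HodgeCM.Model.ToyG2.SplitAllGood
import Summits.HodgeConjecture.HodgeCM.Model.ToyG2.ThetaModel3
import Summits.HodgeConjecture.HodgeCM.StubTree.Qw8NoN3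
import Summits.HodgeConjecture.HodgeCM.Model.ToyG2.DescentFacts3_2
import Summits.HodgeConjecture.HodgeCM.Model.Toy.InertAtom

/-!
# The F4 row of the load-bearing census of `COR_CM_of_descentFactsB₄`

`COR_CM_of_descentFactsB₄ (M) (hR) (hN1) (hN2) (h4 : F4) (h5 : F5) (hu : F-H0) (hb : F7d-B) (hd : D) : HC_CM`.

* `Obj.TypSeparating K Φ` — the Galois-type separation of the CM pair `(K,Φ)`: every atom (of any object of the
  exterior toy universe) realising one of the Galois types of `A_{(K,Φ)}` has degree `≥ [K:ℚ]` (this holds when `Φ` is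
  a PRIMITIVE CM type; e.g. `K = ℚ(ζ₁₃)`, `Φ = {σ₁,…,σ₆}` — not formalised here);
* `h1Rigid_of_typSeparating` — type separation ⇒ `H¹(A_{(K,Φ)})` is rigid (`Obj.H1Rigid`), by the link lemma
  `typ_eq_of_coefQ_ne_zero` of `HodgeCM.Model.Toy.LefTypes` (a nonzero eigen-coordinate of a Hodge map links indices
  of equal Galois type) and the coordinate expansion `repr_baseChange_eB`;
* `pbUniverse₃_profile` — for `K` Galois of degree `≥ 12` with a rigid `A_{(K,Φ)}`, the pullback-family modifier
  `(toyUniverse₃ 1 4)♭` satisfies `ModelAxioms`, `RealisationExistsFace`, N1, N2, N3, N4, F5, D, F-H0 and `¬ HC_CM`;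
  hence (`COR_CM_of_descentFactsB₄` itself) `¬ (F4 ∧ F7d-B)` there:
  **given hR and the other seven binders, `{F4, F7d-B}` cannot BOTH be dropped** — conditional on ONE type-separated
  (e.g. primitive) CM pair of degree `≥ 12`, Galois.

Which of F4 / F7d-B fails in `U♭` is not decided here (F4 is the designed failure: the cup `B¹ × B² → H⁶` of the
inert atom leaves `B♭³ = 0`; F7d-B in `U♭` is open).  All proofs kernel-checked; nothing is cited.
-/

noncomputable section

namespace HodgeCM.Toy

open Literature.AlgebraicGeometry.Motives
open scoped TensorProduct
open exteriorPower Module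

namespace Obj

variable {X Y : Obj}

/-- a linear map all of whose eigen-coordinates vanish is zero -/
theorem lin_eq_zero_of_coefQ_eq_zero (φ : Y.L →ₗ[ℚ] X.L) (h : ∀ s t, coefQ φ s t = 0) : φ = 0 := by
  have hC : φ.baseChange ℂ = 0 := by
    refine Basis.ext Y.eB fun t => ?_
    rw [LinearMap.zero_apply]
    refine X.eB.repr.injective ?_
    rw [map_zero]
    ext s
    rw [repr_baseChange_eB, h s t]
    rfl
  refine LinearMap.ext fun ℓ => funext fun i => ?_
  have h1 : φ.baseChange ℂ ((1 : ℂ) ⊗ₜ[ℚ] ℓ) = (1 : ℂ) ⊗ₜ[ℚ] φ ℓ := LinearMap.baseChange_tmul _ _ _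
  rw [hC, LinearMap.zero_apply] at h1
  let s : X.Idx := ⟨i, algebraMap (X.atom i).F ℂ⟩
  have h2 := X.repr_one_tmul (φ ℓ) s
  rw [← h1, map_zero, Finsupp.zero_apply] at h2
  have h3 : algebraMap (X.atom i).F ℂ ((φ ℓ) i) = 0 := h2.symm
  exact (map_eq_zero_iff _ (algebraMap (X.atom i).F ℂ).injective).mp h3

/-- (Ported verbatim from the HodgeCMPerL package; no docstring in the source.) -/
theorem exists_coefQ_ne_zero {φ : Y.L →ₗ[ℚ] X.L} (hφ : φ ≠ 0) : ∃ s t, coefQ φ s t ≠ 0 := by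
  by_contra h
  push Not at h
  exact hφ (lin_eq_zero_of_coefQ_eq_zero φ h)

/-- one atom's field is a factor of the lattice -/
theorem finrank_atom_le (Y : Obj) (j : Y.s.toType) : finrank ℚ (Y.atom j).F ≤ finrank ℚ Y.L :=
  LinearMap.finrank_le_finrank_of_injective (f := LinearMap.single ℚ (fun i => ((Y.atom i).F : Type)) j)
    fun x y h => by simpa using congr_fun h j

/-- **Galois-type separation** of the CM pair `(K,Φ)`: every atom of every object realising one of the Galois types
`typ (⋆, τ) = {γ | γ ∘ τ ∈ Φ}` of `A_{(K,Φ)}` has degree `≥ [K:ℚ]`.  (Holds when `Φ` is primitive.) -/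
def TypSeparating (K : CMField) (Φ : CMType K) : Prop :=
  ∀ (Y : Obj) (t : Y.Idx) (s : (cmObj K Φ).Idx), (cmObj K Φ).typ s = Y.typ t →
    finrank ℚ K ≤ finrank ℚ (Y.atom t.1).F

/-- **type separation ⇒ rigidity of `H¹(A_{(K,Φ)})`** (link lemma `typ_eq_of_coefQ_ne_zero`). -/
theorem h1Rigid_of_typSeparating {K : CMField} {Φ : CMType K} (h : TypSeparating K Φ) : (cmObj K Φ).H1Rigid := by
  intro Y φ hφ hrank
  by_contra hne
  obtain ⟨s, t, hst⟩ := exists_coefQ_ne_zero hne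
  have htyp := typ_eq_of_coefQ_ne_zero (⟨φ, hφ⟩ : Hom (cmObj K Φ) Y) hst
  have h1 := h Y t s htyp
  have h2 := finrank_atom_le Y t.1
  rw [finrank_L_cmObj] at hrank
  omega

end Obj

end HodgeCM.Toy

namespace HodgeCM.ToyG2

open HodgeCM.Toy
open Literature.AlgebraicGeometry.Motives
open scoped TensorProduct

/-- **The profile of `(toyUniverse₃ 1 4)♭`** for a rigid CM atom `A_{(K,Φ)}`, `K` Galois of degree `≥ 12`:
`ModelAxioms`, the face realisation, N1, N2, N3, N4, F5, D, F-H0 hold and `HC_CM` fails. -/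
theorem pbUniverse₃_profile {K : CMField} [IsGalois ℚ K] (h12 : 12 ≤ Module.finrank ℚ K) (Φ : CMType K)
    (hS : (cmObj K Φ).H1Rigid) :
    (toyUniverse₃ 1 4).pbMod.ModelAxioms ∧ (toyUniverse₃ 1 4).pbMod.RealisationExistsFace ∧
      (toyUniverse₃ 1 4).pbMod.Fact_cupExterior ∧ (toyUniverse₃ 1 4).pbMod.Fact_cup_hodge ∧
      (toyUniverse₃ 1 4).pbMod.Fact_pull_H0 ∧ (toyUniverse₃ 1 4).pbMod.Fact_hodge_F0 ∧
      (toyUniverse₃ 1 4).pbMod.Fact_cupAssoc ∧ (toyUniverse₃ 1 4).pbMod.Fact_dimProd ∧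
      (toyUniverse₃ 1 4).pbMod.Fact_unitH0 ∧ ¬ (toyUniverse₃ 1 4).pbMod.HC_CM := by
  have M : (toyUniverse₃ 1 4).ModelAxioms := toyUniverse₃_modelAxioms_all 1 4
  have hR : (toyUniverse₃ 1 4).RealisationExistsFace := ThetaUiso.realisationExistsFace₃ 1 4 le_rfl (by norm_num)
  have hN1 : (toyUniverse₃ 1 4).Fact_cupExterior := fact3_cupExterior exteriorHodgeData traceSys (gplOf 1 4)
  have hN2 : (toyUniverse₃ 1 4).Fact_cup_hodge := fact3_cup_hodge traceSys (gplOf 1 4)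
  have hN3 : (toyUniverse₃ 1 4).Fact_pull_H0 := fact3_pull_H0 exteriorHodgeData traceSys (gplOf 1 4)
  have hN4 : (toyUniverse₃ 1 4).Fact_hodge_F0 := fact3_hodge_F0 traceSys (gplOf 1 4)
  have h5 : (toyUniverse₃ 1 4).Fact_cupAssoc := fact3_cupAssoc exteriorHodgeData traceSys (gplOf 1 4)
  have hd : (toyUniverse₃ 1 4).Fact_dimProd := fact3_dimProd exteriorHodgeData traceSys (gplOf 1 4)
  have hu : (toyUniverse₃ 1 4).Fact_unitH0 := fact3_unitH0 exteriorHodgeData traceSys (gplOf 1 4)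
  exact Universe.pbMod_profile M hR hN1 hN2 hN3 hN4 h5 hd hu h12 Φ
    (inert_cmProd_of_h1Rigid exteriorHodgeData traceSys (gplOf 1 4) hS (by norm_num) (by omega))

/-- **F4 row (conditional form).**  If some Galois CM field `K` of degree `≥ 12` carries a type-separated CM type
(e.g. a primitive one), then there is a universe with `ModelAxioms`, `RealisationExistsFace`, N1, N2, N3, N4, F5,
`Fact_dimProd`, F-H0 in which `HC_CM` fails and — by `COR_CM_of_descentFactsB₄` itself — F4 and F7d-B do not both
hold: **`{F4, F7d-B}` cannot both be dropped from `COR_CM_of_descentFactsB₄`**. -/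
theorem descentFactsB₄_realised_needs_F4_or_gysinDescentB
    (hsep : ∃ (K : CMField) (Φ : CMType K), IsGalois ℚ K ∧ 12 ≤ Module.finrank ℚ K ∧ Obj.TypSeparating K Φ) :
    ∃ U : Universe, U.ModelAxioms ∧ U.RealisationExistsFace ∧ U.Fact_cupExterior ∧ U.Fact_cup_hodge ∧
      U.Fact_pull_H0 ∧ U.Fact_hodge_F0 ∧ U.Fact_cupAssoc ∧ U.Fact_dimProd ∧ U.Fact_unitH0 ∧
      ¬ (U.Fact_cupAlg ∧ U.Fact_gysinDescentB) ∧ ¬ U.HC_CM := by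
  obtain ⟨K, Φ, hG, h12, hsep⟩ := hsep
  obtain ⟨M, hR, hN1, hN2, hN3, hN4, h5, hd, hu, hHC⟩ :=
    pbUniverse₃_profile h12 Φ (Obj.h1Rigid_of_typSeparating hsep)
  exact ⟨_, M, hR, hN1, hN2, hN3, hN4, h5, hd, hu,
    fun h => hHC (HodgeCM.Assembly.COR_CM_of_descentFactsB₄ _ M hR hN1 hN2 h.1 h5 hu h.2 hd), hHC⟩

end HodgeCM.ToyG2

end
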